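import Literature.Computability.QuantumComplexity.LowWeightPauliPropagation
import HarnessLib

/-!
# Weight truncation off the scrambling average: the all-or-nothing law and the transient-weight floor

Source primitive: `Literature.Computability.QuantumComplexity.LocalScrambling` — the typed AVERAGE-case
guarantee `lowWeight_mse_le` for the weight-`k` Heisenberg estimator `lowWeightValue k = Tr(O^{(k)} ρ)`
(recursion `heisTrunc`) of [AngrisaniEtAl2024, Theorem 1 / Corollary 18] — and the branching rule of
Pauli propagation `PauliPropagation.rotConj_pauliString_of_anticomm` / `…_half_pi_of_anticomm` / `…_pi`
([RudolphEtAl2025, §II B eq. (14)], [BegusicGrayChan2024, Results §Sparse Pauli dynamics]). Print states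
the limitation of the average guarantee only qualitatively: it holds "only for most …, but not for all"
circuits of the ensemble, "there could be randomly sampled circuits for which our classical algorithm
yields a large estimation error" [AngrisaniEtAl2024, Introduction]; "there will be some circuits, i.e.,
certain rotation angles, for which our algorithm fails" [AngrisaniEtAl2024, Discussion]. This module
types that negative half exactly, for the SAME estimator, as finite matrix identities:

* §1 `truncWeight_smul_pauliString`, `heisTrunc_obs_zero`: truncating one string is keep-or-kill, and a
  killed observable stays `0` through every later layer.
* §2–3 `cliffStep` / `cliffCoef` / `cliff_step` (one Clifford-angle rotation `R_G(π/2)` maps the string `T`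
  to ONE string with a unit phase), the explicit Heisenberg TRAJECTORY `cliffTraj L G T : Fin (L+1) → strings`
  of a string through a Clifford-rotation skeleton with its unit phase `cliffPhase` (`norm_cliffPhase`), the exact
  observable `heisExact_cliff = (c·cliffPhase) • σ_{cliffTraj 0}`, and the **all-or-nothing law** as two theorems:
  `heisTrunc_cliff_of_le` (every truncated cut has weight `≤ k` ⇒ the estimate IS the exact observable)
  and `heisTrunc_cliff_of_gt` (some truncated cut has weight `> k` ⇒ the estimate is the ZERO operator).
* §4 `echo_heisTrunc`, `echo_heisExact`, `echo_values` (**transient-weight floor**): through the two-layer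
  echo `R_G(π/2), R_G(π/2)` an anticommuting string travels `T → G·T → T`; if `k < |G·T|` the estimate of
  `⟨σ_T⟩` is `0` on EVERY state while the exact value is `−Tr(σ_T ρ)` — the whole signal is lost although
  the observable is as local at the bottom of the circuit as at the top.
* §5 `landscape_ops`, `landscape_error`, `landscape_pair` (**single-axis landscape**, the typed form of
  "certain rotation angles fail"): through `1, R_G(θ)` the error is `sin θ · Tr(iσ_Gσ_T ρ)`, and the squared
  errors at `θ` and `θ + π/2` sum to `|Tr(iσ_Gσ_T ρ)|²` (so the four-angle landscape average is half of it).
* §6–8 `stringState` (`(1+σ_S)/2ⁿ`: positive semidefinite, trace one, `Tr(σ_T ρ_S) = [T = Iⁿ] + [T = S]`),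
  the strings `xAll = X⋯X`, `zSingle i = Z_i` (anticommuting, `|X⋯X · Z_i| = n`), and `echo_witness`: for
  EVERY register, site `i` and `k < n` the echo estimate of `⟨Z_i⟩` on `ρ_{Z_i}` is `0`, the exact value is
  `−1`, the squared error is `1 = ‖Z_i‖²` (`frobSq_pauliString`); `falsifier` is the `n = 2, k = 1` case.
* §9 `framed_idFrame`, `no_framewise_bound`, `echo_average_le` (**no de-randomised Theorem 1**): the
  identity frame reproduces the bare skeleton, so the sum that `lowWeight_mse_le` bounds by
  `(2/3)^{k+1}‖O‖²` ON AVERAGE has a term equal to `‖O‖²`; the average theorem itself applies to the same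
  skeleton BY NAME (so the bad frames are few, as `card_lowWeight_error_gt_le` counts). §10 `numbers`.

Scope (honest): identities about ONE estimator (`LocalScrambling.heisTrunc`) on explicit Clifford /
single-axis skeletons; nothing here concerns other truncation rules, running times, noise or any device,
the cited average theorem is untouched, and nothing here proves or refutes a quantum advantage.
-/

noncomputable section

open Matrix Finset Complex
open scoped ComplexOrder

namespace Literature.Computability.QuantumComplexity.LocalScrambling.TransientFloor

open PauliPath PauliPropagation LocalScrambling

variable {ι : Type*} [Fintype ι] [DecidableEq ι]

/-! ## 1. Truncating a single string: keep or kill -/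

/-- Pauli coefficients of a scaled string: `Tr(σ_S · cσ_T) = c·2ⁿ·[S = T]` (orthogonality of the Pauli
basis). [cite: AngrisaniEtAl2024, §9.1 (Pauli expansion, eq. (pauliexp): Tr(P Q) = 2ⁿ δ_{PQ})] -/
theorem pauliCoeff_smul_pauliString (c : ℂ) (T S : ι → Pauli) :
    pauliCoeff (c • pauliString T) S = if S = T then c * (2 : ℂ) ^ Fintype.card ι else 0 := by
  rw [pauliCoeff_smul, pauliCoeff_eq, trace_pauliString_mul_pauliString]
  split_ifs <;> simp

/-- **Keep or kill**: the weight-`k` truncation of a single string keeps it when `|T| ≤ k` and returns `0`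
otherwise. [cite: SchusterEtAl2024, §2.2 (𝒫_{≤ℓ} keeps exactly the strings of weight ≤ ℓ)] [cite: AngrisaniEtAl2024, §Background ("truncating all Pauli strings with weight larger than k")] -/
theorem truncWeight_smul_pauliString (k : ℕ) (c : ℂ) (T : ι → Pauli) :
    truncWeight k (c • pauliString T) = if strWeight T ≤ k then c • pauliString T else 0 := by
  have h0 : ∀ S, pauliCoeff (0 : Matrix (ι → Bool) (ι → Bool) ℂ) S = 0 := fun S => by
    rw [pauliCoeff_eq, Matrix.mul_zero, Matrix.trace_zero]
  refine eq_of_forall_pauliCoeff_eq fun S => ?_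
  rw [pauliCoeff_truncWeight, pauliCoeff_smul_pauliString]
  by_cases hT : strWeight T ≤ k
  · rw [if_pos hT, pauliCoeff_smul_pauliString]
    by_cases hST : S = T
    · subst hST; simp [hT]
    · simp [hST]
  · rw [if_neg hT, h0]
    by_cases hST : S = T
    · subst hST; simp [hT]
    · simp [hST]

/-- **A killed observable stays killed**: the weight-`k` Heisenberg recursion is linear, so the zero
observable stays zero through every later layer. [cite: AngrisaniEtAl2024, §Background (the truncated Heisenberg recursion O^{(k)})] -/
theorem heisTrunc_obs_zero (k L : ℕ) (W : Fin L → Matrix (ι → Bool) (ι → Bool) ℂ) :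
    heisTrunc k L W 0 = 0 := by
  simpa using heisTrunc_smul k L W 0 0

/-! ## 2. One Clifford-angle rotation: an explicit string-to-string step -/

/-- The string reached from `T` through `R_G(π/2)` in the Heisenberg picture: `T` if `G, T` commute, the
product string `G·T` if they anticommute. [cite: BegusicGrayChan2024, Results §Sparse Pauli dynamics (Clifford angles do not branch)] [cite: RudolphEtAl2025, §II B eq. (14)] -/
def cliffStep (G T : ι → Pauli) : ι → Pauli := if strSign G T = 1 then T else stringMul G T

/-- The unit phase of that step: `1` (commuting) or `i·phase(G,T)` (anticommuting, `iσ_Gσ_T =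
i·phase(G,T)·σ_{G·T}`). [cite: RudolphEtAl2025, §II B eq. (14) (P′ = iGP)] -/
def cliffCoef (G T : ι → Pauli) : ℂ := if strSign G T = 1 then 1 else Complex.I * stringPhase G T

omit [DecidableEq ι] in
/-- The product phase of two strings is a unit, `|phase(P,Q)| = 1`. [cite: VinkhuijzenEtAl2023, §3.1 (the Pauli group up to phases γ = ±1, ±i)] -/
theorem norm_stringPhase_eq_one (P Q : ι → Pauli) : ‖stringPhase P Q‖ = 1 := by
  rw [stringPhase, norm_prod]
  refine Finset.prod_eq_one fun i _ => ?_
  cases P i <;> cases Q i <;> simp [Pauli.letterPhase]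

omit [DecidableEq ι] in
/-- `|cliffCoef G T| = 1`: a Clifford step loses no amplitude. [cite: BegusicGrayChan2024, Results §Sparse Pauli dynamics (θ = kπ/2: one term of unit modulus remains)] -/
theorem norm_cliffCoef (G T : ι → Pauli) : ‖cliffCoef G T‖ = 1 := by
  unfold cliffCoef
  split_ifs
  · exact norm_one
  · rw [norm_mul, Complex.norm_I, norm_stringPhase_eq_one, one_mul]

/-- **The Clifford step**: `R_G(π/2)† (c σ_T) R_G(π/2) = (c · cliffCoef G T) σ_{cliffStep G T}` — one string
in, one string out ("the number of Paulis will not increase"). [cite: BegusicGrayChan2024, Results §Sparse Pauli dynamics (θ = kπ/2)] [cite: RudolphEtAl2025, §II B eq. (14)] -/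
theorem cliff_step (G T : ι → Pauli) (c : ℂ) :
    (pauliRot (Real.pi / 2) G)ᴴ * (c • pauliString T) * pauliRot (Real.pi / 2) G =
      (c * cliffCoef G T) • pauliString (cliffStep G T) := by
  rw [Matrix.mul_smul, Matrix.smul_mul, ← rotConj_eq, cliffCoef, cliffStep]
  rcases OTOC.strSign_eq_one_or G T with h | h
  · rw [rotConj_pauliString_of_comm _ h, if_pos h, if_pos h, mul_one]
  · have h1 : strSign G T ≠ 1 := by rw [h]; norm_num
    rw [rotConj_pauliString_half_pi_of_anticomm h, if_neg h1, if_neg h1, pauliString_mul, smul_smul,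
      smul_smul, mul_assoc]

/-! ## 3. Clifford skeletons: the explicit trajectory and the all-or-nothing law -/

/-- The **Clifford-rotation skeleton** with generators `G j`: layer `j` is `R_{G j}(π/2)`.
[cite: BegusicGrayChan2024, Results §Sparse Pauli dynamics (U_σ(θ) at Clifford angles)] -/
def cliffLayers {L : ℕ} (G : Fin L → ι → Pauli) : Fin L → Matrix (ι → Bool) (ι → Bool) ℂ :=
  fun j => pauliRot (Real.pi / 2) (G j)

/-- The Clifford layers are unitary. [cite: RudolphEtAl2025, §II B eq. (13)] -/
theorem cliffLayers_unitary {L : ℕ} (G : Fin L → ι → Pauli) (j : Fin L) :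
    (cliffLayers G j)ᴴ * cliffLayers G j = 1 :=
  conjTranspose_mul_self_pauliRot _ _

/-- The **Heisenberg trajectory** of the string `T` through the skeleton, cut by cut: `cliffTraj L G T m` is the
string at cut `m` (between layers `m − 1` and `m`); `cliffTraj (last) = T` enters at the top, the cuts
`m = L, …, 1` are exactly the strings the weight truncation inspects, and `cliffTraj 0` leaves at the bottom
(never truncated). [cite: AngrisaniEtAl2024, §Background (back-propagating each Pauli; Clifford gates transform each Pauli to another Pauli)] -/
def cliffTraj : (L : ℕ) → (Fin L → ι → Pauli) → (ι → Pauli) → Fin (L + 1) → ι → Pauli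
  | 0, _, T => fun _ => T
  | L + 1, G, T => fun m =>
      Fin.lastCases (motive := fun _ => ι → Pauli) T
        (fun m' => cliffTraj L (fun i => G i.castSucc) (cliffStep (G (Fin.last L)) T) m') m

/-- The **trajectory phase**: the product of the unit phases picked up along the way.
[cite: RudolphEtAl2025, §II B eq. (14)] -/
def cliffPhase : (L : ℕ) → (Fin L → ι → Pauli) → (ι → Pauli) → ℂ
  | 0, _, _ => 1
  | L + 1, G, T => cliffCoef (G (Fin.last L)) T * cliffPhase L (fun i => G i.castSucc) (cliffStep (G (Fin.last L)) T)

omit [DecidableEq ι] in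
/-- The trajectory enters with `T` at the top cut. [cite: AngrisaniEtAl2024, §Background (back-propagating each Pauli in the observable through the circuit)] -/
theorem cliffTraj_last (L : ℕ) (G : Fin L → ι → Pauli) (T : ι → Pauli) : cliffTraj L G T (Fin.last L) = T := by
  cases L with
  | zero => rfl
  | succ L => simp [cliffTraj]

omit [DecidableEq ι] in
/-- Below the top layer the trajectory continues from the stepped string. [cite: AngrisaniEtAl2024, §Background (back-propagating each Pauli through the circuit, layer by layer)] -/
theorem cliffTraj_castSucc (L : ℕ) (G : Fin (L + 1) → ι → Pauli) (T : ι → Pauli) (m : Fin (L + 1)) :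
    cliffTraj (L + 1) G T m.castSucc = cliffTraj L (fun i => G i.castSucc) (cliffStep (G (Fin.last L)) T) m := by
  simp [cliffTraj]

omit [DecidableEq ι] in
/-- `|cliffPhase| = 1`: a Clifford trajectory loses no amplitude. [cite: BegusicGrayChan2024, Results §Sparse Pauli dynamics] -/
theorem norm_cliffPhase : ∀ (L : ℕ) (G : Fin L → ι → Pauli) (T : ι → Pauli), ‖cliffPhase L G T‖ = 1 := by
  intro L
  induction L with
  | zero => intro G T; simp [cliffPhase]
  | succ L ih => intro G T; rw [cliffPhase, norm_mul, norm_cliffCoef, ih, one_mul]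

/-- **Exact side**: the exact Heisenberg observable of `c σ_T` through a Clifford skeleton is the single
string at the bottom cut with its unit phase, `(c · cliffPhase) σ_{cliffTraj 0}`. [cite: AngrisaniEtAl2024, §Background (Clifford gates transform each Pauli to another Pauli)] -/
theorem heisExact_cliff : ∀ (L : ℕ) (G : Fin L → ι → Pauli) (T : ι → Pauli) (c : ℂ),
    heisExact L (cliffLayers G) (c • pauliString T) = (c * cliffPhase L G T) • pauliString (cliffTraj L G T 0) := by
  intro L
  induction L with
  | zero => intro G T c; simp [cliffPhase, cliffTraj]
  | succ L ih =>
    intro G T c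
    have h0 := cliffTraj_castSucc L G T 0
    rw [Fin.castSucc_zero] at h0
    rw [heisExact_succ, show cliffLayers G (Fin.last L) = pauliRot (Real.pi / 2) (G (Fin.last L)) from rfl,
      cliff_step, show (fun i : Fin L => cliffLayers G i.castSucc) = cliffLayers (fun i => G i.castSucc) from rfl,
      ih, cliffPhase, h0, mul_assoc]

/-- **All-or-nothing law (kept)**: if every truncated cut of the trajectory (`m ≥ 1`) has weight `≤ k`, the
weight-`k` estimate IS the exact Heisenberg observable — zero error. [cite: AngrisaniEtAl2024, §Background (weight truncation keeps the strings of weight ≤ k)] [cite: BegusicGrayChan2024, Results §Sparse Pauli dynamics (Clifford angles do not branch)] -/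
theorem heisTrunc_cliff_of_le (k : ℕ) : ∀ (L : ℕ) (G : Fin L → ι → Pauli) (T : ι → Pauli) (c : ℂ),
    (∀ m : Fin (L + 1), 0 < (m : ℕ) → strWeight (cliffTraj L G T m) ≤ k) →
      heisTrunc k L (cliffLayers G) (c • pauliString T) = heisExact L (cliffLayers G) (c • pauliString T) := by
  intro L
  induction L with
  | zero => intro G T c _; rfl
  | succ L ih =>
    intro G T c hle
    have hT : strWeight T ≤ k := by simpa [cliffTraj_last] using hle (Fin.last (L + 1)) (by simp)
    rw [heisTrunc_succ, heisExact_succ, truncWeight_smul_pauliString, if_pos hT,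
      show cliffLayers G (Fin.last L) = pauliRot (Real.pi / 2) (G (Fin.last L)) from rfl, cliff_step,
      show (fun i : Fin L => cliffLayers G i.castSucc) = cliffLayers (fun i => G i.castSucc) from rfl]
    refine ih _ _ _ fun m hm => ?_
    rw [← cliffTraj_castSucc]
    exact hle m.castSucc (by simpa using hm)

/-- **All-or-nothing law (killed)**: if some truncated cut of the trajectory (`m ≥ 1`) has weight `> k`, the
weight-`k` estimate is the ZERO operator, whatever the later layers do; with `heisTrunc_cliff_of_le` the
squared error of a string observable on a Clifford skeleton is `0` or the full `|Tr(U†OU ρ)|²`, never in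
between. [cite: AngrisaniEtAl2024, Introduction ("not for all … a large estimation error")] [cite: BegusicGrayChan2024, Results §Sparse Pauli dynamics] -/
theorem heisTrunc_cliff_of_gt (k : ℕ) : ∀ (L : ℕ) (G : Fin L → ι → Pauli) (T : ι → Pauli) (c : ℂ),
    (∃ m : Fin (L + 1), 0 < (m : ℕ) ∧ k < strWeight (cliffTraj L G T m)) →
      heisTrunc k L (cliffLayers G) (c • pauliString T) = 0 := by
  intro L
  induction L with
  | zero => rintro G T c ⟨m, hm, _⟩; exact absurd hm (by simp)
  | succ L ih =>
    rintro G T c ⟨m, hm, hk⟩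
    rw [heisTrunc_succ, truncWeight_smul_pauliString,
      show cliffLayers G (Fin.last L) = pauliRot (Real.pi / 2) (G (Fin.last L)) from rfl,
      show (fun i : Fin L => cliffLayers G i.castSucc) = cliffLayers (fun i => G i.castSucc) from rfl]
    by_cases hT : strWeight T ≤ k
    · rw [if_pos hT, cliff_step]
      refine ih _ _ _ ⟨m.castPred ?_, ?_, ?_⟩
      · intro hlast
        rw [hlast, cliffTraj_last] at hk
        exact absurd hT (not_le.2 hk)
      · simpa using hm
      · rwa [← cliffTraj_castSucc, Fin.castSucc_castPred]
    · rw [if_neg hT, Matrix.mul_zero, Matrix.zero_mul]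
      exact heisTrunc_obs_zero k L _

/-! ## 4. The transient-weight floor: local at both ends, estimate zero -/

/-- The **echo skeleton**: two layers of the same Clifford rotation `R_G(π/2)` (the circuit is `R_G(π)`,
which maps every string to `±` itself). [cite: BegusicGrayChan2024, Results §Sparse Pauli dynamics (Clifford angles)] -/
def echoLayers (G : ι → Pauli) : Fin 2 → Matrix (ι → Bool) (ι → Bool) ℂ := cliffLayers fun _ => G

/-- The echo layers are unitary. [cite: RudolphEtAl2025, §II B eq. (13)] -/
theorem echoLayers_unitary (G : ι → Pauli) (j : Fin 2) : (echoLayers G j)ᴴ * echoLayers G j = 1 :=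
  cliffLayers_unitary _ j

omit [DecidableEq ι] in
/-- The echo trajectory of an anticommuting string has the transient `G·T` at its middle cut.
[cite: RudolphEtAl2025, §II B eq. (14)] -/
theorem cliffTraj_echo_one {G T : ι → Pauli} (h : strSign G T = -1) :
    cliffTraj 2 (fun _ : Fin 2 => G) T 1 = stringMul G T := by
  have h1 : strSign G T ≠ 1 := by rw [h]; norm_num
  rw [show (1 : Fin 3) = (Fin.last 1).castSucc from rfl, cliffTraj_castSucc, cliffTraj_last, cliffStep, if_neg h1]

/-- **Transient-weight floor, operator form**: for `G` anticommuting with `T` and `k < |G·T|` the weight-`k`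
estimate of `c σ_T` through the echo is the ZERO operator — the law `heisTrunc_cliff_of_gt` at the middle
cut. [cite: AngrisaniEtAl2024, Introduction ("not for all … a large estimation error")] -/
theorem echo_heisTrunc (k : ℕ) {G T : ι → Pauli} (h : strSign G T = -1)
    (hGT : k < strWeight (stringMul G T)) (c : ℂ) :
    heisTrunc k 2 (echoLayers G) (c • pauliString T) = 0 :=
  heisTrunc_cliff_of_gt k 2 (fun _ => G) T c ⟨1, Nat.one_pos, by rwa [cliffTraj_echo_one h]⟩

/-- **Transient-weight floor, exact side**: the exact Heisenberg observable of `c σ_T` through the echo is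
`(c·sign(G,T)) σ_T` — as local as `σ_T` (`−c σ_T` in the anticommuting case). [cite: BegusicGrayChan2024, Results §Sparse Pauli dynamics (θ = π: strings map to ± themselves)] -/
theorem echo_heisExact (G T : ι → Pauli) (c : ℂ) :
    heisExact 2 (echoLayers G) (c • pauliString T) = (c * strSign G T) • pauliString T := by
  have hC : circuitUnitary 2 (echoLayers G) = pauliRot Real.pi G := by
    show pauliRot (Real.pi / 2) G * (pauliRot (Real.pi / 2) G * 1) = pauliRot Real.pi G
    rw [Matrix.mul_one, pauliRot_mul_pauliRot, add_halves]
  rw [heisExact_eq_conj, hC, Matrix.mul_smul, Matrix.smul_mul, ← rotConj_eq, rotConj_pauliString_pi,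
    smul_smul]

/-- **Transient-weight floor, value form**: for `G` anticommuting with `T` and `k < |G·T|`, on EVERY state
`ρ` the weight-`k` estimate of `⟨σ_T⟩` through the echo is `0` while the exact value is `−Tr(σ_T ρ)`.
[cite: AngrisaniEtAl2024, Introduction ("not for all"); Discussion ("certain rotation angles, for which our algorithm fails")] -/
theorem echo_values (k : ℕ) {G T : ι → Pauli} (h : strSign G T = -1)
    (hGT : k < strWeight (stringMul G T)) (ρ : Matrix (ι → Bool) (ι → Bool) ℂ) :
    lowWeightValue k (echoLayers G) ρ (pauliString T) = 0 ∧
      noisyValue 0 (echoLayers G) ρ (pauliString T) = -(pauliString T * ρ).trace := by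
  constructor
  · rw [lowWeightValue, ← one_smul ℂ (pauliString T), echo_heisTrunc k h hGT, Matrix.zero_mul,
      Matrix.trace_zero]
  · rw [← trace_heisExact_mul, ← one_smul ℂ (pauliString T), echo_heisExact, h, one_mul, Matrix.smul_mul,
      Matrix.trace_smul, one_smul, neg_one_smul]

/-! ## 5. The single-axis landscape: error `sin θ`, Clifford-shifted pairs sum to the signal -/

/-- The **single-axis skeleton** `1, R_G(θ)`: one rotation by an arbitrary angle above an idle layer (so
the second truncation acts AFTER the branching); both layers are unitary (`conjTranspose_mul_self_pauliRot`).
[cite: AngrisaniEtAl2024, Discussion ("structured circuits with correlated parameters … certain rotation angles")] -/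
def axisLayers (θ : ℝ) (G : ι → Pauli) : Fin 2 → Matrix (ι → Bool) (ι → Bool) ℂ :=
  fun j => if j = Fin.last 1 then pauliRot θ G else 1

/-- **Landscape, operator form**: for `G` anticommuting with `T`, `|T| ≤ k < |G·T|`, the exact observable of
`σ_T` through `1, R_G(θ)` is `cos θ σ_T + i sin θ σ_Gσ_T` and its weight-`k` estimate keeps only `cos θ σ_T`.
[cite: RudolphEtAl2025, §II B eq. (14) (cos θ P + sin θ P′)] [cite: AngrisaniEtAl2024, §Background (weight truncation)] -/
theorem landscape_ops (θ : ℝ) (k : ℕ) {G T : ι → Pauli} (h : strSign G T = -1)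
    (hT : strWeight T ≤ k) (hGT : k < strWeight (stringMul G T)) :
    heisExact 2 (axisLayers θ G) (pauliString T) =
        (Real.cos θ : ℂ) • pauliString T + (Complex.I * (Real.sin θ : ℂ)) • (pauliString G * pauliString T) ∧
      heisTrunc k 2 (axisLayers θ G) (pauliString T) = (Real.cos θ : ℂ) • pauliString T := by
  have htop : axisLayers θ G (Fin.last 1) = pauliRot θ G := by simp [axisLayers]
  have hbot : ∀ i : Fin 1, axisLayers θ G i.castSucc = 1 := by intro i; simp [axisLayers, Fin.ext_iff]
  have hstep : (pauliRot θ G)ᴴ * pauliString T * pauliRot θ G =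
      (Real.cos θ : ℂ) • pauliString T + (Complex.I * (Real.sin θ : ℂ)) • (pauliString G * pauliString T) := by
    rw [← rotConj_eq, rotConj_pauliString_of_anticomm _ h]
  constructor
  · rw [heisExact_succ, htop, hstep, heisExact_succ, hbot, conjTranspose_one, Matrix.one_mul, Matrix.mul_one]
    rfl
  · rw [heisTrunc_succ, htop, ← one_smul ℂ (pauliString T), truncWeight_smul_pauliString, if_pos hT,
      one_smul, hstep, heisTrunc_succ, hbot, conjTranspose_one, Matrix.one_mul, Matrix.mul_one, heisTrunc_zero]
    rw [show truncWeight k ((Real.cos θ : ℂ) • pauliString T +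
          (Complex.I * (Real.sin θ : ℂ)) • (pauliString G * pauliString T)) =
        truncWeight k ((Real.cos θ : ℂ) • pauliString T) +
          truncWeight k ((Complex.I * (Real.sin θ : ℂ) * stringPhase G T) • pauliString (stringMul G T)) by
      rw [pauliString_mul, smul_smul, truncWeight_add],
      truncWeight_smul_pauliString, if_pos hT, truncWeight_smul_pauliString, if_neg (not_le.2 hGT), add_zero]

/-- **Landscape, value form**: under the same hypotheses the estimation error at angle `θ` on a state `ρ` is
exactly `sin θ · Tr(iσ_Gσ_T ρ)`. [cite: AngrisaniEtAl2024, Discussion ("certain rotation angles, for which our algorithm fails")] -/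
theorem landscape_error (θ : ℝ) (k : ℕ) {G T : ι → Pauli} (h : strSign G T = -1)
    (hT : strWeight T ≤ k) (hGT : k < strWeight (stringMul G T)) (ρ : Matrix (ι → Bool) (ι → Bool) ℂ) :
    noisyValue 0 (axisLayers θ G) ρ (pauliString T) - lowWeightValue k (axisLayers θ G) ρ (pauliString T) =
      (Real.sin θ : ℂ) * (Complex.I • (pauliString G * pauliString T) * ρ).trace := by
  obtain ⟨hex, htr⟩ := landscape_ops θ k h hT hGT
  rw [← trace_heisExact_mul, lowWeightValue, hex, htr, Matrix.add_mul, Matrix.trace_add, add_sub_cancel_left,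
    Matrix.smul_mul, Matrix.trace_smul, Matrix.smul_mul, Matrix.trace_smul, smul_eq_mul, smul_eq_mul]
  ring

/-- **Clifford-shifted pairs sum to the signal**: the squared errors at `θ` and `θ + π/2` add up to
`|Tr(iσ_Gσ_T ρ)|²`; so over the four angles `θ₀ + jπ/2` the structured landscape's average squared error is
half of it, a constant, where the scrambled average is `(2/3)^{k+1}`. [cite: AngrisaniEtAl2024, Discussion (average-case analysis; certain rotation angles fail)] -/
theorem landscape_pair (θ : ℝ) (k : ℕ) {G T : ι → Pauli} (h : strSign G T = -1)
    (hT : strWeight T ≤ k) (hGT : k < strWeight (stringMul G T)) (ρ : Matrix (ι → Bool) (ι → Bool) ℂ) :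
    ‖noisyValue 0 (axisLayers θ G) ρ (pauliString T) - lowWeightValue k (axisLayers θ G) ρ (pauliString T)‖ ^ 2 +
      ‖noisyValue 0 (axisLayers (θ + Real.pi / 2) G) ρ (pauliString T) -
        lowWeightValue k (axisLayers (θ + Real.pi / 2) G) ρ (pauliString T)‖ ^ 2 =
      ‖(Complex.I • (pauliString G * pauliString T) * ρ).trace‖ ^ 2 := by
  rw [landscape_error θ k h hT hGT, landscape_error _ k h hT hGT, Real.sin_add_pi_div_two, norm_mul,
    norm_mul, mul_pow, mul_pow, Complex.norm_real, Complex.norm_real, Real.norm_eq_abs, Real.norm_eq_abs,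
    sq_abs, sq_abs, ← add_mul, Real.sin_sq_add_cos_sq, one_mul]

/-! ## 6. The one-string witness state -/

/-- The **one-string state** `ρ_S = (1 + σ_S)/2ⁿ`, the normalised projector onto the `+1` eigenspace of
`σ_S` (a state for `S ≠ Iⁿ`). [cite: NielsenChuang2010, §10.5.1 (stabilizer projectors (I + g)/2)] -/
def stringState (S : ι → Pauli) : Matrix (ι → Bool) (ι → Bool) ℂ :=
  ((2 : ℂ) ^ Fintype.card ι)⁻¹ • (1 + pauliString S)

/-- **The one-string state is positive semidefinite** (`ρ_S = 2^{−(n+1)} (1+σ_S)†(1+σ_S)`).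
[cite: NielsenChuang2010, §10.5.1] -/
theorem stringState_posSemidef (S : ι → Pauli) : (stringState S).PosSemidef := by
  have hH : (1 + pauliString S)ᴴ = 1 + pauliString S := by
    rw [conjTranspose_add, conjTranspose_one, conjTranspose_pauliString]
  have hsq : (1 + pauliString S) * (1 + pauliString S) = (2 : ℂ) • (1 + pauliString S) := by
    rw [Matrix.add_mul, Matrix.mul_add, Matrix.mul_add, Matrix.one_mul, Matrix.mul_one, Matrix.one_mul,
      pauliString_mul_self, two_smul]
    abel
  have hA : stringState S =
      (((2 : ℂ) ^ Fintype.card ι)⁻¹ * (2 : ℂ)⁻¹) • ((1 + pauliString S)ᴴ * (1 + pauliString S)) := by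
    rw [hH, hsq, smul_smul, mul_assoc, inv_mul_cancel₀ (two_ne_zero' ℂ), mul_one, stringState]
  have h2 : (0 : ℂ) ≤ ((2 : ℂ) ^ Fintype.card ι)⁻¹ := by
    rw [← Complex.ofReal_ofNat, ← Complex.ofReal_pow, ← Complex.ofReal_inv]
    exact Complex.zero_le_real.2 (by positivity)
  have h3 : (0 : ℂ) ≤ (2 : ℂ)⁻¹ := by
    rw [← Complex.ofReal_ofNat, ← Complex.ofReal_inv]
    exact Complex.zero_le_real.2 (by positivity)
  rw [hA]
  exact (Matrix.posSemidef_conjTranspose_mul_self _).smul (mul_nonneg h2 h3)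

/-- `Tr(σ_T (1 + σ_S)) = 2ⁿ([T = Iⁿ] + [T = S])` (Pauli orthogonality). [cite: AngrisaniEtAl2024, §9.1 (Tr(P Q) = 2ⁿ δ_{PQ})] [cite: NielsenChuang2010, §10.5.1 (the projector (I + g)/2)] -/
theorem trace_pauliString_mul_one_add (T S : ι → Pauli) :
    (pauliString T * (1 + pauliString S)).trace =
      (if T = fun _ => Pauli.I then (2 : ℂ) ^ Fintype.card ι else 0) +
        (if T = S then (2 : ℂ) ^ Fintype.card ι else 0) := by
  have hT : (pauliString T).trace = if T = fun _ => Pauli.I then (2 : ℂ) ^ Fintype.card ι else 0 := by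
    simpa using trace_pauliString_mul_pauliString T (fun _ => Pauli.I)
  rw [Matrix.mul_add, Matrix.mul_one, Matrix.trace_add, trace_pauliString_mul_pauliString, hT]

/-- **The one-string state has trace one** (`S ≠ Iⁿ`). [cite: NielsenChuang2010, §10.5.1] -/
theorem stringState_trace {S : ι → Pauli} (hS : S ≠ fun _ => Pauli.I) : (stringState S).trace = 1 := by
  have h2 : ((2 : ℂ) ^ Fintype.card ι) ≠ 0 := pow_ne_zero _ two_ne_zero
  have h := trace_pauliString_mul_one_add (fun _ => Pauli.I) S
  rw [pauliString_const_I, Matrix.one_mul, if_pos rfl, if_neg (Ne.symm hS), add_zero] at h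
  rw [stringState, Matrix.trace_smul, h, smul_eq_mul, inv_mul_cancel₀ h2]

/-- **Moments of the one-string state**: `Tr(σ_T ρ_S) = [T = Iⁿ] + [T = S]` — so `Tr(σ_S ρ_S) = 1` for
`S ≠ Iⁿ` and `Tr(σ_T ρ_S) = 0` for `T ∉ {Iⁿ, S}`. [cite: NielsenChuang2010, §10.5.1] -/
theorem trace_pauliString_mul_stringState (T S : ι → Pauli) :
    (pauliString T * stringState S).trace =
      (if T = fun _ => Pauli.I then (1 : ℂ) else 0) + (if T = S then (1 : ℂ) else 0) := by
  have h2 : ((2 : ℂ) ^ Fintype.card ι) ≠ 0 := pow_ne_zero _ two_ne_zero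
  rw [stringState, Matrix.mul_smul, Matrix.trace_smul, trace_pauliString_mul_one_add, smul_eq_mul, mul_add]
  congr 1 <;> split_ifs <;> simp [h2]

/-! ## 7. Concrete strings: the all-`X` generator and a one-site `Z` -/

/-- The weight-one string with `Z` at site `i`. [cite: NielsenChuang2010, §10.5.1 (Pauli group elements)] -/
def zSingle (i : ι) : ι → Pauli := Function.update (fun _ => Pauli.I) i Pauli.Z

/-- The all-`X` generator (a transversal `X` rotation axis). [cite: BegusicGrayChan2024, Results §Sparse Pauli dynamics (rotation axes σ)] -/
def xAll : ι → Pauli := fun _ => Pauli.X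

omit [Fintype ι] in
/-- `Z_i ≠ Iⁿ`. [cite: NielsenChuang2010, §10.5.1 (non-identity Pauli group elements)] -/
theorem zSingle_ne_I (i : ι) : zSingle i ≠ fun _ => Pauli.I := by
  intro h
  simpa [zSingle] using congrFun h i

/-- `|Z_i| = 1` (one non-identity letter). [cite: AngrisaniEtAl2024, §Background (the weight of a Pauli string = its number of non-identity letters)] -/
theorem strWeight_zSingle (i : ι) : strWeight (zSingle i) = 1 := by
  rw [strWeight_eq, Finset.card_eq_one]
  refine ⟨i, Finset.ext fun j => ?_⟩
  by_cases hj : j = i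
  · subst hj; simp [zSingle]
  · simp [zSingle, hj]

/-- `X⋯X` anticommutes with `Z_i` (exactly one anticommuting site). [cite: NielsenChuang2010, §10.5.1 (two Pauli group elements commute iff they anticommute on an even number of sites)] -/
theorem strSign_xAll_zSingle (i : ι) : strSign (xAll : ι → Pauli) (zSingle i) = -1 := by
  rw [strSign_eq, ← Finset.prod_erase_mul _ _ (Finset.mem_univ i)]
  rw [Finset.prod_eq_one fun j hj => ?_]
  · simp [xAll, zSingle, Pauli.sign]
  · simp [xAll, zSingle, Finset.ne_of_mem_erase hj, Pauli.sign]

/-- The transient string `X⋯X · Z_i` (letters `X, …, X, XZ ∝ Y, X, …, X`) has FULL weight `n`.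
[cite: AngrisaniEtAl2024, §Background (weight = number of non-identity letters)] [cite: RudolphEtAl2025, §II B eq. (14) (the new string P′ = iGP)] -/
theorem strWeight_xAll_mul_zSingle (i : ι) : strWeight (stringMul (xAll : ι → Pauli) (zSingle i)) = Fintype.card ι := by
  rw [strWeight_eq, ← Finset.card_univ]
  congr 1
  refine Finset.filter_true_of_mem fun j _ => ?_
  by_cases hji : j = i
  · subst hji; simp [stringMul, xAll, zSingle, Pauli.letterMul]
  · simp [stringMul, xAll, zSingle, hji, Pauli.letterMul]

/-! ## 8. The floor is attained with modulus one, for every `k < n` -/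

/-- **Echo witness (∃-free)**: on any register, for every site `i` and every `k < n`, the weight-`k` estimate
of `⟨Z_i⟩` through the echo `R_{X⋯X}(π/2), R_{X⋯X}(π/2)` on the state `ρ_{Z_i}` is `0`, the exact value is
`−1`, and the squared error is `1 = ‖Z_i‖²` (normalised Frobenius norm) — where the scrambled AVERAGE is
`(2/3)^{k+1}‖Z_i‖²`; both ends of the trajectory have weight `|Z_i| = 1` (`strWeight_zSingle`).
[cite: AngrisaniEtAl2024, Theorem 1 / Corollary 18 (the average bound); Introduction ("not for all")] -/
theorem echo_witness (i : ι) {k : ℕ} (hk : k < Fintype.card ι) :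
    lowWeightValue k (echoLayers (xAll : ι → Pauli)) (stringState (zSingle i)) (pauliString (zSingle i)) = 0 ∧
      noisyValue 0 (echoLayers (xAll : ι → Pauli)) (stringState (zSingle i)) (pauliString (zSingle i)) = -1 ∧
      ‖noisyValue 0 (echoLayers (xAll : ι → Pauli)) (stringState (zSingle i)) (pauliString (zSingle i)) -
          lowWeightValue k (echoLayers (xAll : ι → Pauli)) (stringState (zSingle i)) (pauliString (zSingle i))‖ ^ 2 =
        frobSq (pauliString (zSingle i)) := by
  have hGT : k < strWeight (stringMul (xAll : ι → Pauli) (zSingle i)) := by rwa [strWeight_xAll_mul_zSingle]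
  obtain ⟨h0, h1⟩ := echo_values k (strSign_xAll_zSingle i) hGT (stringState (zSingle i))
  rw [trace_pauliString_mul_stringState, if_neg (zSingle_ne_I i), if_pos rfl, zero_add] at h1
  exact ⟨h0, h1, by rw [h0, h1, frobSq_pauliString]; norm_num⟩

/-- **Cheapest falsifier** (`n = 2`, `k = 1`, `G = XX`, `O = Z₂`): the trajectory `IZ → XY → IZ` is killed at
its weight-2 middle cut; truncated value `0`, exact value `−1`. [cite: AngrisaniEtAl2024, Introduction ("not for all")] -/
theorem falsifier :
    lowWeightValue 1 (echoLayers (xAll : Fin 2 → Pauli)) (stringState (zSingle 1)) (pauliString (zSingle 1)) = 0 ∧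
      noisyValue 0 (echoLayers (xAll : Fin 2 → Pauli)) (stringState (zSingle 1)) (pauliString (zSingle 1)) = -1 :=
  let h := echo_witness (ι := Fin 2) 1 (k := 1) (by simp)
  ⟨h.1, h.2.1⟩

/-! ## 9. No de-randomised Theorem 1: the identity frame reproduces the skeleton -/

/-- The **identity frame** `(Iⁿ, 0)`: no Pauli, no axis relabelling. [cite: AngrisaniEtAl2024, Definition 5 (the frame ensemble contains the identity)] -/
def idFrame : Frame ι := (fun _ => Pauli.I, fun _ => 0)

/-- The identity frame's unitary is `1`. [cite: AngrisaniEtAl2024, Definition 5] -/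
theorem frameU_idFrame : frameU (idFrame : Frame ι) = 1 := by
  have hc : cycAll (fun _ : ι => (0 : Fin 3)) = 1 := by
    have : (fun i : ι => cyc ((fun _ : ι => (0 : Fin 3)) i)) = fun _ => (1 : Matrix Bool Bool ℂ) := by
      funext i; simp [cyc]
    rw [cycAll, this, tensorAll_one]
  rw [frameU, idFrame, pauliString_const_I, Matrix.one_mul, hc]

/-- Framing by the identity frame at every layer returns the bare skeleton. [cite: AngrisaniEtAl2024, Definition 5] -/
theorem framed_idFrame {L : ℕ} (U : Fin L → Matrix (ι → Bool) (ι → Bool) ℂ) :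
    framed U (fun _ => (idFrame : Frame ι)) = U := by
  funext j
  rw [framed, frameU_idFrame, Matrix.one_mul]

/-- **No framewise version of the average theorem**: on every register with a site `i` and for every `k < n`
there are a UNITARY two-layer skeleton, a positive semidefinite trace-one state, an observable with
`‖O‖² = 1` and a frame (the named echo construction at the identity frame) at which the term of the sum
that `lowWeight_mse_le` bounds by `(2/3)^{k+1}‖O‖²` ON AVERAGE equals `‖O‖²` and exceeds that bound.
[cite: AngrisaniEtAl2024, Introduction ("our provable guarantees hold only for most …, but not for all")] -/
theorem no_framewise_bound (i : ι) {k : ℕ} (hk : k < Fintype.card ι) :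
    ∃ (U : Fin 2 → Matrix (ι → Bool) (ι → Bool) ℂ) (ρ O : Matrix (ι → Bool) (ι → Bool) ℂ)
      (φ : Fin 2 → Frame ι),
      (∀ j, (U j)ᴴ * U j = 1) ∧ ρ.PosSemidef ∧ ρ.trace = 1 ∧ frobSq O = 1 ∧
        ‖noisyValue 0 (framed U φ) ρ O - lowWeightValue k (framed U φ) ρ O‖ ^ 2 = frobSq O ∧
        (2 / 3 : ℝ) ^ (k + 1) * frobSq O <
          ‖noisyValue 0 (framed U φ) ρ O - lowWeightValue k (framed U φ) ρ O‖ ^ 2 := by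
  refine ⟨echoLayers xAll, stringState (zSingle i), pauliString (zSingle i), fun _ => idFrame, echoLayers_unitary _,
    stringState_posSemidef _, stringState_trace (zSingle_ne_I i), frobSq_pauliString _, ?_, ?_⟩
  · rw [framed_idFrame]; exact (echo_witness i hk).2.2
  · rw [framed_idFrame, (echo_witness i hk).2.2, frobSq_pauliString, mul_one]
    exact pow_lt_one₀ (by norm_num) (by norm_num) (Nat.succ_ne_zero k)

/-- **The average theorem governs the same skeleton** (consistency, BY NAME): averaged over all `12^{2n}`
frames the echo skeleton's squared error is at most `(2/3)^{k+1}‖Z_i‖²` — the framewise value `1` of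
`no_framewise_bound` is carried by few frames, as `card_lowWeight_error_gt_le` counts.
[cite: AngrisaniEtAl2024, Theorem 1 / Corollary 18] -/
theorem echo_average_le (i : ι) (k : ℕ) :
    ((12 : ℝ) ^ (Fintype.card ι * 2))⁻¹ *
        ∑ φ : Fin 2 → Frame ι,
          ‖noisyValue 0 (framed (echoLayers (xAll : ι → Pauli)) φ) (stringState (zSingle i)) (pauliString (zSingle i)) -
              lowWeightValue k (framed (echoLayers (xAll : ι → Pauli)) φ) (stringState (zSingle i))
                (pauliString (zSingle i))‖ ^ 2 ≤
      (2 / 3 : ℝ) ^ (k + 1) * frobSq (pauliString (zSingle i)) :=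
  lowWeight_mse_le k _ (echoLayers_unitary _) (stringState_posSemidef _) (stringState_trace (zSingle_ne_I i)) _

/-! ## 10. Numbers -/

/-- Orders of magnitude: at truncation weight `k = 10` the scrambled average of the squared error is at most
`(2/3)^{11} < 0.0117` (times `‖O‖²`) while the echo skeleton's identity-frame value is `1`; at
`k = 49 < n = 50` the gap is `(2/3)^{50} < 2·10⁻⁹` against `1`. [cite: AngrisaniEtAl2024, Theorem 3 (k ∈ Ω(log(ε⁻¹δ⁻¹)))] -/
theorem numbers : (2 / 3 : ℝ) ^ 11 < 0.0117 ∧ (2 / 3 : ℝ) ^ 50 < 2e-9 ∧ (0.0117 : ℝ) < 1 :=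
  ⟨by norm_num, by norm_num, by norm_num⟩

end Literature.Computability.QuantumComplexity.LocalScrambling.TransientFloor
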